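import Mathlib
import Literature.LinearAlgebra.Matrix.PermanentSubperm
import Literature.Computability.AlgebraicComplexity.StandardFamilies
import Summits.ValiantsHypothesis.ValiantsHypothesis.Theses.TwistedDetRank

/-!
# `TwistedDetRank.TdrPerThree` (stmt-ValiantsHypothesis-6290) — `tdr(per₃) ≤ 2`

The route's calibration support statement `TdrPerThree`: the generic `3 × 3` permanent is a sum of
two Hadamard-twisted determinants, `per₃(X) = det(E₀ ∘ X) + det(E₁ ∘ X)` for some
`E₀, E₁ ∈ ℂ^{3×3}`.

Proof: an explicit INTEGER witness (no cube roots of unity are needed, contrary to the symmetric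
ansatz `a·J`, `(1−a)·F` over `ℚ(ζ₃)` suggested in the route text):

  `E₀ = !![1, -1, 1; 1, 1, 1; 1, 1, 1]`,  `E₁ = !![-1, 1, -2; 0, 1, 2; 1, 1, 0]`.

Indeed `det(E₀ ∘ X) = x₀₀x₁₁x₂₂ − x₀₀x₁₂x₂₁ + x₀₁x₁₀x₂₂ − x₀₁x₁₂x₂₀ + x₀₂x₁₀x₂₁ − x₀₂x₁₁x₂₀`
(the determinant with the sign of `x₀₁` flipped) and
`det(E₁ ∘ X) = 2·(x₀₀x₁₂x₂₁ + x₀₁x₁₂x₂₀ + x₀₂x₁₁x₂₀)`, whose sum is `per₃(X)`.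
Equivalently, on `S₃` the function `sgn` is the sum of the two Birkhoff-cone points
`u = (1, 1, −1; −1, 1, 1)` and `v = (0, 0, 2; 0, −2, −2)` (values on `id, (012), (021); (01), (02),
(12)`). The Lean proof expands both sides with `Matrix.det_fin_three` and the tree's
`Matrix.permanent_fin_three_row` and closes with `ring`. (`r = 1` is impossible by Marcus–Minc 1961,
so `tdr(per₃) = 2`; that converse is not part of this item.) [folklore]
-/

namespace Summit.ValiantsHypothesis.ValiantsHypothesis.Theorems

open MvPolynomial

-- `Summit.ValiantsHypothesis.ValiantsHypothesis.…` is the tree's mandated single-conjunct layout (Sub = Summit).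
set_option linter.dupNamespace false

/-- **`TdrPerThree` holds** (item stmt-ValiantsHypothesis-6290 of route TwistedDetRank): there are
`E₀, E₁ : Matrix (Fin 3) (Fin 3) ℂ` with `perPoly (Fin 3) ℂ = det(E₀ ∘ X) + det(E₁ ∘ X)`, namely the
integer matrices `E₀ = !![1, -1, 1; 1, 1, 1; 1, 1, 1]` and `E₁ = !![-1, 1, -2; 0, 1, 2; 1, 1, 0]`;
hence `tdr(per₃) ≤ 2`. [folklore] -/
theorem tdrPerThree_proof :
    Summit.ValiantsHypothesis.ValiantsHypothesis.Theses.TwistedDetRank.TdrPerThree := by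
  unfold Summit.ValiantsHypothesis.ValiantsHypothesis.Theses.TwistedDetRank.TdrPerThree
  refine ⟨![!![1, -1, 1; 1, 1, 1; 1, 1, 1], !![-1, 1, -2; 0, 1, 2; 1, 1, 0]], ?_⟩
  simp only [Literature.Computability.AlgebraicComplexity.perPoly, Matrix.mvPolynomialX,
    Matrix.permanent_fin_three_row, Matrix.det_fin_three, Fin.sum_univ_two, Matrix.of_apply,
    Matrix.cons_val_zero, Matrix.cons_val_one, Matrix.cons_val_two, Matrix.head_cons,
    Matrix.tail_cons, map_one, map_neg, map_zero, map_ofNat]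
  ring

end Summit.ValiantsHypothesis.ValiantsHypothesis.Theorems
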